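import Literature.MathematicalPhysics.QuantumFieldTheory.Balaban1983to89.T4ContinuumYM4Torus
import Literature.MathematicalPhysics.QuantumFieldTheory.Balaban1983to89.Node00.DatumAvLayer

/-!
# The DATUM ASSEMBLER: a finite-`ε` datum `FiniteEpsData F G` from Bałaban's renormalisation-group machine read as DATA
# (the non-placeholder counterpart of `T4FiniteEpsInhabited.stubData`), and its instance at NODE 00's averaging of record

YM-PLAN Track A, node **N23** = binder B1 `hD : D.IsPrintedAveraged` of `T4ContinuumYM4Torus.continuumYM4_torus_of_BetaPertH`
(T4ApexPrinted :135), seat `pub-ymgap-dag-n23-a` (HUMAN RULING D-0062; strategy -a = the GLUE by name, children → node, with the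
children as hypotheses).  Bookkeeping ∕ typing only: NOTHING analytic of the series is proved or asserted; no datum of record is
CLAIMED here (see HONEST FRAMING); one finite four-torus programme at fixed `ε` ([Balaban1989LargeFieldII] Thm 1 scope) — NOT the
continuum limit on ℝ⁴, NOT infinite volume, NOT OS, NOT a mass gap, NOT the Clay problem.

## What this file does (and only this)

The carrier `T4Continuum.FiniteEpsData F G` (T4Continuum.lean :794) has six fields — Bałaban's construction `C :
B16.Construction`, the history-dependent β-functions `βfun`, the two modelling clauses `curries`, `fwd`, the averaging maps `av`
and the dictionary `real : Realisation F G C av` (seven more fields) — and NODE 00's scoping report (`NODE00-SCOPING.md` v0.4 §2.12,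
seat pub-ymgap-node00-def) splits the datum of record `D₀` FIELD BY FIELD into a READY layer (lattices, configurations, Bałaban's
printed block averaging (0.4), the renormalisation transformation as the Radon–Nikodym transport, the Wilson start; LANDED as
`Node00/DatumAvLayer.lean`, p386661) and the RG MACHINE (the β-functions of [Balaban1987RG1] (1.20)–(1.22), the effective actions
with their expansion terms and small-field domains, the characteristic functions `χ_k`, Bałaban's large-field operation `R` of
[Balaban1988Convergent] (0.2) ∕ [Balaban1989LargeFieldI] (0.4), the clause predicates of [Balaban1987RG1] Thm 1 ∕ Thm 3 and
[Balaban1989LargeFieldII] §2) — «Stage 5», not yet a tree object.  This file is the KERNEL GLUE BETWEEN THE TWO: it types the RG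
machine as ONE input bundle `RGMachine F G` — exactly the fields `FiniteEpsData` stores verbatim plus the two proof obligations on
`R` that `Realisation` demands and that cannot be discharged without knowing `R` — and ASSEMBLES, for EVERY machine `M` and every
measurable, Haar-absolutely-continuous averaging family `av`, the datum `M.datum av … : FiniteEpsData F G`, discharging every
other field BY NAME from the tree:

* `C := M.construction av` with, per run `p = (K, m, g₀)` on the `K`-th torus `F.P K` of the family: `flow := FlowStepRuns.genFlow
  M.βfun g₀` — the coupling sequence generated FORWARD from the bare coupling by (0.18)∕(0.20) with the machine's β-functions
  ([Balaban1987RG1] (0.17)–(0.20) pp. 255–256; tree `FlowStepRuns` §6) —, `Cfg k := GaugeField (F.P K) k G` ([Balaban1987RG1] (0.1)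
  p. 251), `numSites k := |T₁^{(k)}|` (the model named in `B12.RunData`'s docstring), `ρ k := (R T)^k ρ₀` (`M.dens`, [Balaban1988Convergent]
  (0.2) p. 244: `ρ₀ = e^{−E}·exp(−A/g₀²)`, `ρ_{k+1} = R(Tρ_k)` with `T` the Radon–Nikodym transport `AveragingRT.rnTransport` along
  `av K k`), and `dom`, `effAction`, `wilsonBG`, `Ek`, `χ`, `Repr`, `IndAss`, `Sect2Form` THE MACHINE'S, verbatim;
* `curries`, `fwd` (and `FlowStepRuns.HaltsOutside`) PROVED — the three modelling clauses of `DagBinding` hold for the forward-generated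
  flow by arithmetic (`FlowStepRuns.modelOf_*` pattern); and the carver's UNGUARDED run-wise leaf (0.20) LOCATED EXACTLY:
  `satisfiesRG_genFlow_iff` — `(genFlow β g₀).SatisfiesRG K ↔ ∀ k < K, β k (g_0,…,g_k) ≤ 1/g_k²` (no overshoot along the generated history) —,
  hence `rgFlow_of_noOvershoot` (the `rg` conjunct of a binding world on the assembled construction, for machines that never overshoot) beside
  the guarded, hypothesis-free `satisfiesRG_construction` (in-interval runs, which is all `DagBinding.endStatementBPrinted_of_nodesP_interval` consumes);
* `endStatementBPrinted_of_nodesP_guarded` (the tree's END headline `DagBinding.endStatementBPrinted_of_nodesP_interval` with its (0.20) leaf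
  GUARDED to in-interval runs — all its proof uses) and, at a world on the assembled construction, `endStatementBPrinted_of_nodes_construction`
  ((B) pinned from the thirteen nodes + the β-window, NO (0.20) binder) ∕ `…_boxBounds` (β-window from box bounds of `M.βfun`);
* the β-SIDE BINDERS AT THE ASSEMBLED CONSTRUCTION FROM BOX PROPERTIES OF `M.βfun` ALONE: `betaBoundsInInterval_construction` (N24's `hβ`) and
  `endpointExistence_construction` (binder B3 = END, node N25's statement; `DagBinding.endpointExistence_of_forwardGenerated`);
* `real`: `cfg := Equiv.refl`, `rho_zero` (constant `e^{−E(p)} > 0`), `Trho := T ρ_k`, `isRT_Trho` from `T4FiniteEpsInhabited.isRT_rnTransport_of_ac`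
  (needs `ρ_k` integrable for `k ≤ K`: `M.integrable_dens`, by induction from the Wilson start through `T` and the machine's
  `integrable_R`), `R := M.R`, `preservesIntegral_R := M.preservesIntegral_R` ((0.4) of [Balaban1989LargeFieldI] — an INPUT),
  `rho_succ_eq := rfl`.

§3 instantiates at `G = SU(N)` and NODE 00's averaging of record `Node00.avOfRecord F N` (Bałaban's centred block averaging (0.3)–(0.4)
p. 253 with the printed inner operation, `Node00/DatumAvLayer`; measurability and `HaarAC` are the tree theorems
`Node00.avOfRecord_measurable ∕ _haarAC`): `datumOfRecord F N M`.  FOR EVERY MACHINE `M`: `Node00.IsDatumOfRecord₀ F N (datumOfRecord F N M)`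
(`rfl`) and hence binder B1 `(datumOfRecord F N M).IsPrintedAveraged` (`Node00.isPrintedAveraged_of_isDatumOfRecord₀`) — B1 for EVERY
machine; node N23's discharge is this statement at the machine OF RECORD (Stage 5, not here); its densities unfold to `Node00.rhoZeroOfRecord` and
`R ∘ Node00.TrhoOfRecord` (`dens_datumOfRecord_zero ∕ _succ`).  §4: the three «∃ datum of record» statements the YM ladder quantifies
(`(B)` pinned; `(B)` + endpoint existence; `(B)` + END + the hybrid-NE7 spine under END — the bodies of the rung items
`…BalabanUVNodes.StabilityBAtRecord`, `…BalabanLadder.UV`) FOLLOW from the corresponding «∃ machine» statements about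
`M.construction` ∕ `datumOfRecord F N M` (`exists_datumOfRecord₀_of_machine*`): the kernel form of «D₀ = the assembler at the machine
of record».

## HONEST FRAMING — what this is NOT

* NOT a datum of record and NOT a second datum: `datum` ∕ `datumOfRecord` are FUNCTIONS of the machine; NODE 00's Stage-5 module
  (seat pub-ymgap-node00-def, definition item «IsRecordOfRecord₅», R422 DEFINITION FIRST) defines THE machine of record `M₀` from
  Bałaban's defining equations, and the ONE datum of record is `datumOfRecord F N M₀` — the same term the binders N24 (B2) and N27 (B5)
  then quantify over (`(datumOfRecord F N M₀).C = M₀.construction _` by `rfl`).  Nothing here chooses `M₀`.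
* NOT a placeholder either: unlike `T4FiniteEpsInhabited.stubData` (zero β-functions, `R := id`, `Sect2Form := False`, at which (B) is
  FALSE by `not_endStatementBPrinted_stub`), no field is stubbed — (B) at `datumOfRecord F N M` is `B16.EndStatementBPrinted
  (M.construction _)`, true or false according to the machine, asserted of none.
* The READINGS are the tree's, not new: `FiniteEpsData.βfun : FlowStep.HBeta` is ONE history-dependent family for all runs
  (`DagBinding.CurriesHBeta`); the construction at run `(K, m, g₀)` lives on the family's torus `F.P K` (torus exponent `F.m`; NODE 00
  §2.12); `R` enters only through `PreservesIntegral` ((0.4)) and integrability preservation (`Realisation`, DIVERGENCE F9 of `T4Continuum`).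

No quotation locus is new in this module: every page reference is one certified for `T4Continuum` (v5), `T4FiniteEpsInhabited`,
`FlowStepRuns`, `Node00/DatumAvLayer` (cell GAPS C-t4l-1, C-pv26g2-3).  Register: [Balaban1987RG1] = Commun. Math. Phys. 109 (1987)
249–301; [Balaban1988Convergent] = 119 (1988) 243–285; [Balaban1989LargeFieldI] = 122 (1989) 175–202; [Balaban1989LargeFieldII] =
122 (1989) 355–392; [Balaban1985Averaging] = 98 (1985) 17–51.
-/

noncomputable section

open MeasureTheory

namespace Literature.MathematicalPhysics.QuantumFieldTheory.Balaban1983to89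

namespace T4DatumAssembly

open Missing AveragingRT T4Continuum T4FiniteEpsInhabited FlowStep FlowStepRuns DagBinding

/-! ## 1. Bałaban's renormalisation-group machine on the family `F`, READ AS DATA -/

/-- **THE RG MACHINE AS AN INPUT BUNDLE** (NODE 00 §2.12 «RG machine», Stage 5): per run `p = (K, m, g₀)` and step `k`, on the gauge
fields of `T^{(k)}` of the `K`-th torus of the family — the history-dependent β-functions `βfun` ([Balaban1987RG1] (1.20)–(1.22), one family
for all runs as `FiniteEpsData` types them), the normalisation constant `E` of the Wilson start `ρ₀ = exp[−(1/g₀²)A − E]`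
([Balaban1988Convergent] Thm 1 p. 262), the small-field domain `dom`, effective action `effAction`, Wilson action of the background
`wilsonBG`, expansion term `Ek` and the clause predicates `Repr`, `IndAss` of [Balaban1987RG1] Thm 1 ∕ Thm 3 (the fields of `B12.RunData`),
the characteristic functions `χ` and the §2-form clause `Sect2Form` of [Balaban1989LargeFieldII] (the extra fields of `B16.RunData`), and
Bałaban's large-field renormalisation operation `R` after step `k+1` with its two properties the dictionary `T4Continuum.Realisation`
consumes: (0.4) `∫(Rρ) = ∫ρ` (`PreservesIntegral`) and preservation of integrability (so that the next renormalisation transformation is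
an honest `IsRT` transform), both in the standing range `k < K`.  DATA, asserting nothing.  VACUITY NOTE (referee ref-D, A4): the clause fields `Repr`, `IndAss`,
`Sect2Form` are FREE in the bundle, so e.g. a machine with `Sect2Form := fun _ _ => True` makes `B16.Thm1Printed (M.construction av)` trivial
(the mirror image of `T4FiniteEpsInhabited.stubData`'s `False`); which machine is Bałaban's — clause fields PINNED to named density-format
predicates of [Balaban1989LargeFieldII] §2, β-functions, `R` — is NODE 00's Stage-5 DEFINITION (R422), not this structure's. [cite: Balaban1988Convergent, (0.2) p.244] -/
structure RGMachine (F : T4Family) (G : Type) [GaugeGroup G] [MeasurableSpace G] [HaarData G] where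
  /-- the history-dependent β-functions `β_{k+1}(g_0, …, g_k)` -/
  βfun : HBeta
  /-- the normalisation constant `E` of `ρ₀ = exp[−(1/g₀²)A − E]`, per run -/
  E : B12.RunParams → ℝ
  /-- the small-field domains -/
  dom : (p : B12.RunParams) → (k : ℕ) → Set (GaugeField (F.P p.K) k G)
  /-- the effective actions `A_k(g_k, V)` -/
  effAction : (p : B12.RunParams) → (k : ℕ) → GaugeField (F.P p.K) k G → ℝ
  /-- the Wilson action `A^η(U_k(V))` of the background configuration -/
  wilsonBG : (p : B12.RunParams) → (k : ℕ) → GaugeField (F.P p.K) k G → ℝ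
  /-- the expansion term `𝐄_k(U_k(V))` of (0.22)–(0.23) -/
  Ek : (p : B12.RunParams) → (k : ℕ) → GaugeField (F.P p.K) k G → ℝ
  /-- the characteristic functions `χ_k` of (2.17) [III] -/
  χ : (p : B12.RunParams) → (k : ℕ) → GaugeField (F.P p.K) k G → ℝ
  /-- clause: `A_k` is given by (0.22)–(0.24) with (0.29) ([Balaban1987RG1] Thm 1, read at step `k`) -/
  Repr : B12.RunParams → ℕ → Prop
  /-- clause: `A_k` satisfies the inductive assumptions (1.1)–(1.22) ([Balaban1987RG1] Thm 3, read at step `k`) -/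
  IndAss : B12.RunParams → ℕ → Prop
  /-- clause: `ρ_k` has the form (2.18) [III] with the §2 [III] bounds ([Balaban1989LargeFieldII] Thm 1, read at step `k`) -/
  Sect2Form : B12.RunParams → ℕ → Prop
  /-- Bałaban's large-field operation `R` after the `(k+1)`-st transformation, on densities on `T^{(k+1)}` -/
  R : (p : B12.RunParams) → (k : ℕ) → Density (F.P p.K) (k + 1) G → Density (F.P p.K) (k + 1) G
  /-- (0.4): `∫ dV (Rρ)(V) = ∫ dV ρ(V)`, `k < K` -/
  preservesIntegral_R : ∀ (p : B12.RunParams) (k : ℕ), k < p.K → PreservesIntegral (R p k)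
  /-- `R` maps integrable densities to integrable densities, `k < K` -/
  integrable_R : ∀ (p : B12.RunParams) (k : ℕ), k < p.K → ∀ ρ : Density (F.P p.K) (k + 1) G,
    Integrable ρ (fieldMeasure (F.P p.K) (k + 1) G) → Integrable (R p k ρ) (fieldMeasure (F.P p.K) (k + 1) G)

/-- **THE END HEADLINE WITH THE (0.20) LEAF GUARDED** — a twin of `DagBinding.endStatementBPrinted_of_nodesP_interval` (DagBinding :1508) asking the
run-wise RG recursion `rgFlow` ONLY ALONG IN-INTERVAL RUNS (`smallCouplings → rgFlow`), which is all the original proof consumes (it uses `hrg P` after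
`intro hsc`): for a dependence-function world with `0 < γ ≤ γ₀`, the thirteen paper nodes at every run, (0.20) along every run that stays in `]0, γ]`,
and the β-window on `]0, γ₀]` give the PINNED end statement (B).  At a forward-generated construction the guarded leaf is a THEOREM
(`RGMachine.satisfiesRG_construction`), whereas the unguarded one needs «no overshoot» (`satisfiesRG_genFlow_iff`). Bookkeeping over the tree's
headline; nothing of the series asserted. [cite: Balaban1989LargeFieldII, Thm 1 p.355 + p.391] -/
theorem endStatementBPrinted_of_nodesP_guarded (w : WorldP) (hγ : 0 < w.γ) {γ₀ : ℝ} (hγ₀ : w.γ ≤ γ₀)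
    (hnodes : ∀ P : B12.RunParams, Nodes (leavesP w P))
    (hrg : ∀ P : B12.RunParams, (leavesP w P).smallCouplings → (leavesP w P).rgFlow)
    (hβ : BetaBoundsInInterval w.C.toB12 γ₀ w.b w.βup) : B16.EndStatementBPrinted w.C := by
  refine endStatementBPrinted_of_worldsP w hγ fun P => uvStability_of_nodes (leavesP w P) (hnodes P) ?_
  intro hsc
  obtain ⟨hlo, hhi⟩ := alongRun_of_inInterval w.C.toB12 hβ hγ₀ P hsc
  exact flowIneq26_of_alongRun (w.withConsts 0 0) P (hrg P hsc) hhi hlo fun k hk => (hsc k hk).1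

namespace RGMachine

section Generic

/-- The input TYPE is inhabited on every family and gauge group (zero β-functions and report fields, `R := id`, clauses `False`) — so the
theorems below quantify over a non-empty class; the witness is the placeholder's content and is deliberately NOT named as a machine
(cf. `T4FiniteEpsInhabited.stubData`, at which (B) is false). [cite: Balaban1988Convergent, (0.2) p.244 (type-level non-vacuity, bookkeeping)] -/
theorem nonempty {F : T4Family} {G : Type} [GaugeGroup G] [MeasurableSpace G] [HaarData G] : Nonempty (RGMachine F G) :=
  ⟨{ βfun := fun _ _ => 0, E := fun _ => 0, dom := fun _ _ => ∅, effAction := fun _ _ _ => 0, wilsonBG := fun _ _ _ => 0,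
     Ek := fun _ _ _ => 0, χ := fun _ _ _ => 0, Repr := fun _ _ => False, IndAss := fun _ _ => False, Sect2Form := fun _ _ => False,
     R := fun _ _ => id, preservesIntegral_R := fun _ _ _ _ => rfl, integrable_R := fun _ _ _ _ h => h }⟩

variable {F : T4Family} {G : Type} [GaugeGroup G] [MeasurableSpace G] [HaarData G]
  (M : RGMachine F G) (av : (K j : ℕ) → Averaging (F.P K) j G)

/-! ## 2. The assembler, generic in the gauge group and the averaging family -/

/-- The Wilson start of the run `p`: `ρ₀ = exp[−(1/g₀²)A(U) − E(p)]` = `e^{−E(p)}` times the tree's Wilson–Boltzmann weight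
`Missing.boltzmann` at `β = g₀⁻²`. [cite: Balaban1988Convergent, Thm 1 p.262] -/
def rhoZero (p : B12.RunParams) : Density (F.P p.K) 0 G :=
  fun U => Real.exp (-M.E p) * boltzmann (F.P p.K) (p.g0⁻¹ ^ 2) U

/-- **The density tower of the run `p` along `av`**: `ρ₀` = the Wilson start, `ρ_{k+1} = R_k (T_k ρ_k)` with `T_k` the Radon–Nikodym
transport `AveragingRT.rnTransport` along `av K k` — [Balaban1988Convergent] (0.2) `ρ_k = (RT)^k ρ₀`, with the machine's `R`. [cite: Balaban1988Convergent, (0.2) p.244] -/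
def dens (p : B12.RunParams) : (k : ℕ) → Density (F.P p.K) k G
  | 0 => M.rhoZero p
  | k + 1 => M.R p k (rnTransport (av p.K k).avg (dens p k))

/-- `ρ₀` is the Wilson start (`rfl`). [cite: Balaban1988Convergent, (0.2) p.244 (bookkeeping)] -/
theorem dens_zero (p : B12.RunParams) : M.dens av p 0 = M.rhoZero p := rfl

/-- `ρ_{k+1} = R_k (T_k ρ_k)` (`rfl`). [cite: Balaban1988Convergent, (0.2) p.244] -/
theorem dens_succ (p : B12.RunParams) (k : ℕ) :
    M.dens av p (k + 1) = M.R p k (rnTransport (av p.K k).avg (M.dens av p k)) := rfl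

/-- `ρ₀` is a positive constant times the Wilson weight — the shape `Realisation.rho_zero` asks for. [cite: Balaban1988Convergent, Thm 1 p.262 (bookkeeping)] -/
theorem rhoZero_shape (p : B12.RunParams) :
    ∃ c : ℝ, 0 < c ∧ ∀ U : GaugeField (F.P p.K) 0 G, M.rhoZero p U = c * boltzmann (F.P p.K) (p.g0⁻¹ ^ 2) U :=
  ⟨Real.exp (-M.E p), Real.exp_pos _, fun _ => rfl⟩

/-- `ρ₀ > 0` pointwise. [cite: Balaban1988Convergent, Thm 1 p.262 (bookkeeping)] -/
theorem rhoZero_pos (p : B12.RunParams) (U : GaugeField (F.P p.K) 0 G) : 0 < M.rhoZero p U :=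
  mul_pos (Real.exp_pos _) (boltzmann_pos (F.P p.K) _ U)

/-- **Bałaban's construction ASSEMBLED from the machine** (a `B16.Construction`: run parameters ↦ run data), per run `p = (K, m, g₀)` on
the `K`-th torus of the family: the coupling flow generated FORWARD from `g₀` by (0.18)∕(0.20) with the machine's β-functions
(`FlowStepRuns.genFlow`); `Cfg k` = the gauge fields on `T^{(k)}` ((0.1)); `numSites k = |T₁^{(k)}|`; densities `ρ_k = (RT)^k ρ₀`
(`dens`); every other field the machine's, verbatim. [cite: Balaban1987RG1, (0.17)–(0.20) pp.255–256] -/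
def construction : B16.Construction := fun p =>
  { flow := genFlow M.βfun p.g0
    Cfg := fun k => GaugeField (F.P p.K) k G
    dom := M.dom p
    effAction := M.effAction p
    wilsonBG := M.wilsonBG p
    Ek := M.Ek p
    numSites := fun k => Fintype.card (Site (F.P p.K) k)
    Repr := M.Repr p
    IndAss := M.IndAss p
    ρ := M.dens av p
    χ := M.χ p
    Sect2Form := M.Sect2Form p }

/-- The assembled construction's flow IS the forward-generated flow (`rfl`). [cite: Balaban1987RG1, (0.17)–(0.20) pp.255–256 (bookkeeping)] -/
theorem construction_flow (p : B12.RunParams) : (M.construction av p).flow = genFlow M.βfun p.g0 := rfl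

/-- Its couplings are `FlowStepRuns.genSeq` (`rfl`). [cite: Balaban1987RG1, (0.17)–(0.20) pp.255–256 (bookkeeping)] -/
theorem construction_g (p : B12.RunParams) : (M.construction av p).flow.g = genSeq M.βfun p.g0 := rfl

/-- Its densities are the tower `dens` (`rfl`). [cite: Balaban1988Convergent, (0.2) p.244 (bookkeeping)] -/
theorem construction_ρ (p : B12.RunParams) : (M.construction av p).ρ = M.dens av p := rfl

/-- Its §2-form clause is the machine's (`rfl`) — so `B16.Thm1Printed (M.construction av)` reads the machine's `Sect2Form` along the
forward-generated runs. [cite: Balaban1989LargeFieldII, Thm 1 p.355 (bookkeeping)] -/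
theorem construction_sect2Form (p : B12.RunParams) : (M.construction av p).Sect2Form = M.Sect2Form p := rfl

/-- MODELLING CLAUSE 1: the run-wise one-variable β-functions CURRY the machine's history family at the run's own earlier couplings
(`DagBinding.CurriesHBeta`) — definitionally, as for `FlowStepRuns.modelOf`. [cite: Balaban1987RG1, §5 p.298 and (1.22) p.264] -/
theorem curries : CurriesHBeta (M.construction av).toB12 M.βfun := fun _ _ _ _ => rfl

/-- MODELLING CLAUSE 2: the runs are generated FORWARD from the bare coupling by (0.20) with the machine's β-functions
(`DagBinding.ForwardGenerated`). [cite: Balaban1987RG1, (0.17)–(0.20) pp.255–256] -/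
theorem forwardGenerated : ForwardGenerated (M.construction av).toB12 M.βfun := by
  refine ⟨fun p => genSeq_zero M.βfun p.g0, fun p k _ _ hrhs => ?_⟩
  show 0 < genSeq M.βfun p.g0 (k + 1) ∧
    1 / (genSeq M.βfun p.g0 (k + 1)) ^ 2 = 1 / (genSeq M.βfun p.g0 k) ^ 2 - M.βfun k (prefixOf (genSeq M.βfun p.g0) k)
  rw [genSeq_succ]
  exact ⟨solveCoupling_pos hrhs, inv_sq_solveCoupling hrhs⟩

/-- MODELLING CLAUSE 3: the runs HALT (coupling `≤ 0`) where (0.20) has no positive solution (`FlowStepRuns.HaltsOutside`). [cite: Balaban1987RG1, (0.18)–(0.20) pp.255–256 (bookkeeping)] -/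
theorem haltsOutside : HaltsOutside (M.construction av).toB12 M.βfun := by
  intro p k _ _ hrhs
  show genSeq M.βfun p.g0 (k + 1) ≤ 0
  rw [genSeq_succ]
  exact solveCoupling_nonpos hrhs

/-- Hence (0.20) `1/g_k² = 1/g_{k+1}² + β_{k+1}(g_k)` holds along every run of the assembled construction that stays in `]0, γ]`
(`FlowStepRuns.satisfiesRG_of_inInterval`). [cite: Balaban1987RG1, (0.20) p.256] -/
theorem satisfiesRG_construction (p : B12.RunParams) {γ : ℝ} (hin : (M.construction av p).flow.InInterval γ p.K) :
    (M.construction av p).flow.SatisfiesRG p.K :=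
  FlowStepRuns.satisfiesRG_of_inInterval (M.forwardGenerated av) (M.haltsOutside av) (M.curries av) p hin

/-- **WHEN DOES THE FORWARD-GENERATED FLOW SATISFY (0.20) UNGUARDED?**  For the flow `FlowStepRuns.genFlow β g₀` (couplings generated
forward by the positive root of (0.20) while the right side is positive, `0` afterwards; run-wise β-functions = `β` curried), the carver's
run-wise leaf `Flow.SatisfiesRG K` — `1/g_k² = 1/g_{k+1}² + β_{k+1}(g_k)` for ALL `k < K`, with NO interval guard — holds IF AND ONLY IF the
β-functions never OVERSHOOT along the generated history: `β k (g_0,…,g_k) ≤ 1/g_k²` for `k < K` (at equality the run dies with `g_{k+1} = 0` and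
(0.20) still holds in the field convention `1/0 = 0`; past a strict overshoot it fails).  Locates exactly what the unguarded `rgFlow` conjunct of a
binding world on a forward-generated construction asks of the machine's `βfun` off the small-coupling box; the GUARDED form along in-interval
runs is `FlowStepRuns.satisfiesRG_of_inInterval`, hypothesis-free. [cite: Balaban1987RG1, (0.18)–(0.20) pp.255–256] -/
theorem satisfiesRG_genFlow_iff (β : HBeta) (g0 : ℝ) (K : ℕ) :
    (genFlow β g0).SatisfiesRG K ↔
      ∀ k, k < K → β k (prefixOf (genSeq β g0) k) ≤ 1 / (genSeq β g0 k) ^ 2 := by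
  have key : ∀ k, (genFlow β g0).β (k + 1) ((genFlow β g0).g k) = β k (prefixOf (genSeq β g0) k) := fun k => by
    show β k (Function.update (prefixOf (genSeq β g0) k) (Fin.last k) (genSeq β g0 k)) = _
    rw [update_prefixOf_last]
  constructor
  · intro h k hk
    have e := h k hk
    rw [key] at e
    by_contra hlt
    push Not at hlt
    have hneg : ¬ 0 < 1 / (genSeq β g0 k) ^ 2 - β k (prefixOf (genSeq β g0) k) := by
      intro h'; linarith
    have h0 : (genFlow β g0).g (k + 1) = 0 := by
      show genSeq β g0 (k + 1) = 0
      rw [genSeq_succ, solveCoupling, if_neg hneg]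
    rw [h0] at e
    simp only [ne_eq, OfNat.ofNat_ne_zero, not_false_eq_true, zero_pow, div_zero, zero_add] at e
    have : (genFlow β g0).g k = genSeq β g0 k := rfl
    rw [this] at e
    linarith
  · intro h k hk
    show 1 / (genSeq β g0 k) ^ 2 = 1 / (genSeq β g0 (k + 1)) ^ 2 + (genFlow β g0).β (k + 1) ((genFlow β g0).g k)
    rw [key k, genSeq_succ]
    rcases (sub_nonneg.mpr (h k hk)).lt_or_eq with hpos | hzero
    · rw [inv_sq_solveCoupling hpos]; ring
    · have hneg : ¬ 0 < 1 / (genSeq β g0 k) ^ 2 - β k (prefixOf (genSeq β g0) k) := fun h' => absurd hzero (ne_of_lt h')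
      rw [solveCoupling, if_neg hneg]
      simp only [ne_eq, OfNat.ofNat_ne_zero, not_false_eq_true, zero_pow, div_zero, zero_add]
      linarith

/-- **At the assembled construction: (0.20) unguarded along the first `K'` steps of the run `p` ⟺ no overshoot of the machine's β-functions along
the generated history** (`satisfiesRG_genFlow_iff`). [cite: Balaban1987RG1, (0.20) p.256] -/
theorem satisfiesRG_construction_iff (p : B12.RunParams) (K' : ℕ) :
    (M.construction av p).flow.SatisfiesRG K' ↔
      ∀ k, k < K' → M.βfun k (prefixOf (genSeq M.βfun p.g0) k) ≤ 1 / (genSeq M.βfun p.g0 k) ^ 2 :=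
  satisfiesRG_genFlow_iff M.βfun p.g0 K'

/-- **The carver's UNGUARDED run-wise leaf `rgFlow` at EVERY run of a binding world on the assembled construction ⟸ the machine never
overshoots** (`∀ p, ∀ k < K, β k (g_0,…,g_k) ≤ 1/g_k²` along generated histories — automatic for a β-family set to `0` off the box `]0,γ₀]^{k+1}`
with `β ≤ γ₀⁻²` on it): the `rg` conjunct of the K1 frame in kernel form. [cite: Balaban1987RG1, (0.20) p.256] -/
theorem rgFlow_of_noOvershoot (w : WorldP) (hC : w.C = M.construction av)
    (h : ∀ (p : B12.RunParams) (k : ℕ), k < p.K →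
      M.βfun k (prefixOf (genSeq M.βfun p.g0) k) ≤ 1 / (genSeq M.βfun p.g0 k) ^ 2)
    (P : B12.RunParams) : (leavesP w P).rgFlow := by
  show (w.C P).flow.SatisfiesRG P.K
  rw [hC]
  exact (M.satisfiesRG_construction_iff av P P.K).mpr (h P)

/-- **THE β-WINDOW BINDER AT THE ASSEMBLED CONSTRUCTION FROM BOX BOUNDS OF THE MACHINE'S β-FUNCTIONS**: `b ≤ β ≤ β⁺` on the boxes `]0,γ₀]^{k+1}`
(`FlowStep.BetaLowerH ∕ BetaUpperH`) give `DagBinding.BetaBoundsInInterval (M.construction av).toB12 γ₀ b β⁺` — the non-node binder `hβ` of N24's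
glue — by `DagBinding.betaBoundsInInterval_of_boxBounds` at `curries`.  Upper half printed ([Balaban1987RG1] p. 264, proof deferred to §5), lower
half UNPRINTED (T09.F); both INPUTS here. [cite: Balaban1987RG1, (1.22) p.264] -/
theorem betaBoundsInInterval_construction {γ₀ b βup : ℝ} (hlo : BetaLowerH b γ₀ M.βfun) (hup : BetaUpperH βup γ₀ M.βfun) :
    BetaBoundsInInterval (M.construction av).toB12 γ₀ b βup :=
  betaBoundsInInterval_of_boxBounds _ M.βfun (M.curries av) hlo hup

/-- **ENDPOINT EXISTENCE (binder B3 = END, node N25's statement) AT THE ASSEMBLED CONSTRUCTION FROM BOX PROPERTIES OF THE MACHINE'S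
β-FUNCTIONS ALONE**: joint continuity and `0 ≤ β ≤ β'` on the boxes `]0,γ₀]^{k+1}` give `DagBinding.EndpointExistence (M.construction av).toB12`
(`DagBinding.endpointExistence_of_forwardGenerated` at `forwardGenerated`) — [Balaban1987RG1] Thm 2 p. 259, endpoint half, whose proof was never
published; the three box properties are INPUTS. [cite: Balaban1987RG1, Thm 2 p.259] -/
theorem endpointExistence_construction {γ₀ β' : ℝ} (hγ₀ : 0 < γ₀) (hβ' : 0 ≤ β') (hcont : BetaContH γ₀ M.βfun)
    (hsign : BetaLowerH 0 γ₀ M.βfun) (hup : BetaUpperH β' γ₀ M.βfun) : EndpointExistence (M.construction av).toB12 :=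
  endpointExistence_of_forwardGenerated _ M.βfun hγ₀ hβ' hcont hsign hup (M.forwardGenerated av)

/-- **(B) PINNED AT A WORLD ON THE ASSEMBLED CONSTRUCTION FROM THE THIRTEEN NODES AND THE β-WINDOW — NO (0.20) LEAF**: for a dependence-function
world `w` with `w.C = M.construction av`, `0 < γ ≤ γ₀`, the thirteen paper nodes at every run and `BetaBoundsInInterval … γ₀ b β⁺`, the pinned end
statement `B16.EndStatementBPrinted w.C` — `endStatementBPrinted_of_nodesP_guarded` with its guarded (0.20) leaf DISCHARGED by `satisfiesRG_construction`
(in-interval runs of a forward-generated flow never halt).  Binder B2 ∕ node N24's glue at the assembled record loses the `hrg` binder. [cite: Balaban1989LargeFieldII, Thm 1 p.355 + p.391] -/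
theorem endStatementBPrinted_of_nodes_construction (w : WorldP) (hC : w.C = M.construction av) (hγ : 0 < w.γ) {γ₀ : ℝ}
    (hγ₀ : w.γ ≤ γ₀) (hnodes : ∀ P : B12.RunParams, Nodes (leavesP w P))
    (hβ : BetaBoundsInInterval w.C.toB12 γ₀ w.b w.βup) : B16.EndStatementBPrinted w.C := by
  refine endStatementBPrinted_of_nodesP_guarded w hγ hγ₀ hnodes (fun P hsc => ?_) hβ
  change (w.C P).flow.InInterval w.γ P.K at hsc
  show (w.C P).flow.SatisfiesRG P.K
  rw [hC] at hsc ⊢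
  exact M.satisfiesRG_construction av P hsc

/-- **… AND WITH THE β-WINDOW FROM BOX BOUNDS OF THE MACHINE'S β-FUNCTIONS**: thirteen nodes at every run of a world on the assembled construction,
`0 < γ ≤ γ₀`, and `b ≤ β ≤ β⁺` on the boxes `]0,γ₀]^{k+1}` for `M.βfun` (with the world's letters `b = w.b`, `β⁺ = w.βup`) give (B) pinned —
the K1 → K2 → K3 chain at the assembled record with BOTH non-node binders of N24's glue (`hrg`, `hβ`) traded for properties of the machine's
β-family (lower half UNPRINTED, T09.F; upper half [Balaban1987RG1] p. 264). [cite: Balaban1989LargeFieldII, Thm 1 p.355 + p.391] -/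
theorem endStatementBPrinted_of_nodes_construction_boxBounds (w : WorldP) (hC : w.C = M.construction av) (hγ : 0 < w.γ) {γ₀ : ℝ}
    (hγ₀ : w.γ ≤ γ₀) (hnodes : ∀ P : B12.RunParams, Nodes (leavesP w P))
    (hlo : BetaLowerH w.b γ₀ M.βfun) (hup : BetaUpperH w.βup γ₀ M.βfun) : B16.EndStatementBPrinted w.C := by
  refine M.endStatementBPrinted_of_nodes_construction av w hC hγ hγ₀ hnodes ?_
  rw [hC]
  exact M.betaBoundsInInterval_construction av hlo hup

/-- If the machine's `R` preserves non-negativity, every density of the tower is non-negative (`ρ₀ > 0`, `T` positivity-preserving by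
`AveragingRT.rnTransport_nonneg`). [cite: Balaban1988Convergent, (0.2) p.244 (kernel property of the tower, bookkeeping)] -/
theorem dens_nonneg (hR : ∀ (p : B12.RunParams) (k : ℕ) (ρ : Density (F.P p.K) (k + 1) G), (∀ V, 0 ≤ ρ V) → ∀ V, 0 ≤ M.R p k ρ V)
    (p : B12.RunParams) : ∀ (k : ℕ) (U : GaugeField (F.P p.K) k G), 0 ≤ M.dens av p k U
  | 0, U => (M.rhoZero_pos p U).le
  | k + 1, U => hR p k _ (rnTransport_nonneg _ _ (dens_nonneg hR p k)) U

variable [RegularGaugeGroup G]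

/-- The Wilson start is integrable (`Missing.integrable_boltzmann`, `β = g₀⁻² ≥ 0`). [cite: Balaban1988Convergent, Thm 1 p.262 (kernel property, bookkeeping)] -/
theorem integrable_rhoZero (p : B12.RunParams) : Integrable (M.rhoZero p) (fieldMeasure (F.P p.K) 0 G) :=
  (integrable_boltzmann RegularGaugeGroup.measurable_reTr (F.P p.K) (sq_nonneg _)).const_mul _

/-- Along a MEASURABLE averaging family with the Haar absolute-continuity bracket `HaarAC` in the standing range, every `ρ_k`, `k ≤ K`, is
integrable: induction from the Wilson start through `T4FiniteEpsInhabited.integrable_rnTransport_of_ac` and the machine's `integrable_R`. [cite: Balaban1988Convergent, (0.2) p.244 (kernel property of the tower, bookkeeping)] -/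
theorem integrable_dens (hmeas : ∀ K j, Measurable (av K j).avg) (hac : ∀ K k, k < K → HaarAC (av K k).avg)
    (p : B12.RunParams) : ∀ k, k ≤ p.K → Integrable (M.dens av p k) (fieldMeasure (F.P p.K) k G)
  | 0, _ => M.integrable_rhoZero p
  | k + 1, hk =>
      M.integrable_R p k (Nat.lt_of_succ_le hk) _
        (integrable_rnTransport_of_ac _ (hmeas p.K k) (hac p.K k (Nat.lt_of_succ_le hk)) _
          (integrable_dens hmeas hac p k (Nat.le_of_succ_le hk)))

/-- **THE REALISATION of the assembled construction by the averaging family** (`T4Continuum.Realisation`, all seven fields): `cfg` = identity,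
`ρ₀ = e^{−E}·`Wilson weight, `Tρ_k` = the Radon–Nikodym transport of `ρ_k` along `av K k` — an honest `Setup.IsRT` transform for `k < K`
(`T4FiniteEpsInhabited.isRT_rnTransport_of_ac` at `integrable_dens`) —, `R` = the machine's with its (0.4), and `ρ_{k+1} = R(Tρ_k)` by `rfl`. [cite: Balaban1988Convergent, (0.2) p.244] -/
def realisation (hmeas : ∀ K j, Measurable (av K j).avg) (hac : ∀ K k, k < K → HaarAC (av K k).avg) :
    Realisation F G (M.construction av) av where
  cfg := fun _ _ _ => Equiv.refl _
  rho_zero := fun K g₀ => ⟨Real.exp (-M.E ⟨K, F.m, g₀⟩), Real.exp_pos _, fun _ => rfl⟩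
  Trho := fun K g₀ k => rnTransport (av K k).avg (M.dens av ⟨K, F.m, g₀⟩ k)
  isRT_Trho := fun K g₀ k hk =>
    isRT_rnTransport_of_ac _ (hmeas K k) (hac K k hk) _ (M.integrable_dens av hmeas hac ⟨K, F.m, g₀⟩ k hk.le)
  R := fun K g₀ k => M.R ⟨K, F.m, g₀⟩ k
  preservesIntegral_R := fun K g₀ k hk => M.preservesIntegral_R ⟨K, F.m, g₀⟩ k hk
  rho_succ_eq := fun _ _ _ _ => rfl

/-- **THE ASSEMBLED DATUM**: finite-`ε` data on the family `F` with gauge group `G` whose construction, β-functions and realisation are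
assembled from the machine `M` and whose averaging maps ARE the given family `av`. A FUNCTION of `M`; no machine is chosen here. [cite: Balaban1989LargeFieldII, Thm 1 + (0.1) pp.355–356] -/
def datum (hmeas : ∀ K j, Measurable (av K j).avg) (hac : ∀ K k, k < K → HaarAC (av K k).avg) : FiniteEpsData F G where
  C := M.construction av
  βfun := M.βfun
  curries := M.curries av
  fwd := M.forwardGenerated av
  av := av
  real := M.realisation av hmeas hac

variable (hmeas : ∀ K j, Measurable (av K j).avg) (hac : ∀ K k, k < K → HaarAC (av K k).avg)

/-- Its averaging maps are the given ones (`rfl`). [cite: Balaban1989LargeFieldII, Thm 1 + (0.1) pp.355–356 (bookkeeping)] -/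
@[simp] theorem datum_av : (M.datum av hmeas hac).av = av := rfl

/-- Its construction is the assembled one (`rfl`). [cite: Balaban1989LargeFieldII, Thm 1 + (0.1) pp.355–356 (bookkeeping)] -/
@[simp] theorem datum_C : (M.datum av hmeas hac).C = M.construction av := rfl

/-- Its β-functions are the machine's (`rfl`). [cite: Balaban1987RG1, (1.22) p.264 (bookkeeping)] -/
@[simp] theorem datum_βfun : (M.datum av hmeas hac).βfun = M.βfun := rfl

/-- Its transported densities `FiniteEpsData.dens` are the tower `dens` (`rfl`). [cite: Balaban1988Convergent, (0.2) p.244 (bookkeeping)] -/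
theorem dens_datum (K : ℕ) (g₀ : ℝ) (k : ℕ) : (M.datum av hmeas hac).dens K g₀ k = M.dens av ⟨K, F.m, g₀⟩ k := rfl

/-- If the given family IS Bałaban's block averaging (0.4) driven by a small-loop average `ℰ`, the assembled datum is (0.4)-averaged
(`T4Continuum.FiniteEpsData.IsBlockAveraged`) — for every machine. [cite: Balaban1987RG1, (0.4) p.253] -/
theorem isBlockAveraged_datum (ℰ : LoopAverage G) (hav : ∀ K j, av K j = BlockAveraging.blockAvg ℰ) :
    (M.datum av hmeas hac).IsBlockAveraged ℰ :=
  fun K j => hav K j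

end Generic

end RGMachine

/-! ## 3. At `SU(N)` and NODE 00's averaging of record: `datumOfRecord`, and binder B1 (node N23) for EVERY machine -/

section Record

variable (F : T4Family) (N : ℕ) [NeZero N] (M : RGMachine F (Matrix.specialUnitaryGroup (Fin N) ℂ))

/-- **THE DATUM ASSEMBLED AT THE AVERAGING OF RECORD**: the machine `M` on `SU(N)` realised along NODE 00's averaging operations of
record `Node00.avOfRecord F N` — Bałaban's centred block averaging (0.3)–(0.4) with the printed inner operation exp[mean log]
(`Node00/DatumAvLayer`; measurability `Node00.avOfRecord_measurable`, Haar bracket `Node00.avOfRecord_haarAC`).  A FUNCTION of `M`: the datum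
of record is its value at NODE 00's machine of record (Stage 5), chosen THERE, not here. [cite: Balaban1987RG1, (0.4) p.253] -/
def datumOfRecord : FiniteEpsData F (Matrix.specialUnitaryGroup (Fin N) ℂ) :=
  M.datum (Node00.avOfRecord F N) (Node00.avOfRecord_measurable F N) (Node00.avOfRecord_haarAC F N)

/-- Its averaging maps are the averaging operations of record (`rfl`). [cite: Balaban1987RG1, (0.4) p.253] -/
@[simp] theorem datumOfRecord_av : (datumOfRecord F N M).av = Node00.avOfRecord F N := rfl

/-- Its construction is the machine's construction assembled along the averaging of record (`rfl`) — the term a binding world of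
record sets as its `C`. [cite: Balaban1989LargeFieldII, Thm 1 + (0.1) pp.355–356 (bookkeeping)] -/
@[simp] theorem datumOfRecord_C : (datumOfRecord F N M).C = M.construction (Node00.avOfRecord F N) := rfl

/-- Its β-functions are the machine's (`rfl`). [cite: Balaban1987RG1, (1.22) p.264 (bookkeeping)] -/
@[simp] theorem datumOfRecord_βfun : (datumOfRecord F N M).βfun = M.βfun := rfl

/-- **NODE N23 ∕ STAGE-0 DATUM CLAUSE, FOR EVERY MACHINE**: the assembled datum IS a datum of record in the Stage-0 sense
`Node00.IsDatumOfRecord₀` (`D.av = avOfRecord F N`, definitionally). [cite: Balaban1987RG1, (0.3)–(0.4) p.253] -/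
theorem isDatumOfRecord₀_datumOfRecord : Node00.IsDatumOfRecord₀ F N (datumOfRecord F N M) := rfl

/-- **BINDER B1 (one-level prescription (0.4)) FOR EVERY MACHINE**: the assembled datum is printed-averaged in the sense
`IsPrintedAveraged₁` (`Node00.isPrintedAveraged₁_of_av`). [cite: Balaban1987RG1, (0.4) p.253] -/
theorem isPrintedAveraged₁_datumOfRecord : (datumOfRecord F N M).IsPrintedAveraged₁ :=
  Node00.isPrintedAveraged₁_of_av F N _ rfl

/-- **BINDER B1 `hD : D.IsPrintedAveraged` (T4ApexPrinted :135) AT THE ASSEMBLED DATUM, FOR EVERY MACHINE** (`Node00.isPrintedAveraged_of_isDatumOfRecord₀`);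
node N23's DISCHARGE is this statement AT THE MACHINE OF RECORD, which NODE 00's Stage 5 defines — not here. [cite: Balaban1987RG1, (0.4) p.253] -/
theorem isPrintedAveraged_datumOfRecord : (datumOfRecord F N M).IsPrintedAveraged :=
  Node00.isPrintedAveraged_of_isDatumOfRecord₀ F N _ (isDatumOfRecord₀_datumOfRecord F N M)

/-- The assembled datum's `ρ₀` of the run `(K, F.m, g₀)` is NODE 00's initial density of record `Node00.rhoZeroOfRecord F N K g₀ (E p)` (`rfl`). [cite: Balaban1988Convergent, Thm 1 p.262] -/
theorem dens_datumOfRecord_zero (K : ℕ) (g₀ : ℝ) :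
    (datumOfRecord F N M).dens K g₀ 0 = Node00.rhoZeroOfRecord F N K g₀ (M.E ⟨K, F.m, g₀⟩) := rfl

/-- Its `ρ_{k+1}` is the machine's `R` applied to NODE 00's renormalisation transform of record of `ρ_k` (`Node00.TrhoOfRecord`; `rfl`):
`ρ_{k+1} = R(Tρ_k)`. [cite: Balaban1988Convergent, (0.2) p.244] -/
theorem dens_datumOfRecord_succ (K : ℕ) (g₀ : ℝ) (k : ℕ) :
    (datumOfRecord F N M).dens K g₀ (k + 1) =
      M.R ⟨K, F.m, g₀⟩ k (Node00.TrhoOfRecord F N K k ((datumOfRecord F N M).dens K g₀ k)) := rfl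

/-- Every transported density of the assembled datum is integrable up to the top level (`integrable_dens` at the record's measurability
and Haar bracket). [cite: Balaban1988Convergent, (0.2) p.244 (kernel property of the tower, bookkeeping)] -/
theorem integrable_dens_datumOfRecord (K : ℕ) (g₀ : ℝ) (k : ℕ) (hk : k ≤ K) :
    Integrable ((datumOfRecord F N M).dens K g₀ k) (fieldMeasure (F.P K) k (Matrix.specialUnitaryGroup (Fin N) ℂ)) :=
  M.integrable_dens (Node00.avOfRecord F N) (Node00.avOfRecord_measurable F N) (Node00.avOfRecord_haarAC F N) ⟨K, F.m, g₀⟩ k hk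

/-- The couplings of the assembled datum's run `(K, F.m, g₀)` are generated forward from `g₀` (`FlowStepRuns.genSeq`; `rfl`), so its bare
coupling is `g₀` (`FiniteEpsData.flow_zero`). [cite: Balaban1987RG1, (0.17) p.255] -/
theorem flow_datumOfRecord (p : B12.RunParams) : ((datumOfRecord F N M).C p).flow = genFlow M.βfun p.g0 := rfl

/-! ## 4. «∃ datum of record» ⟸ «∃ machine» — the three shapes the YM ladder quantifies (kernel) -/

/-- **(B) PINNED AT A STAGE-0 DATUM OF RECORD, WITH RUNS IN EVERY SMALL WINDOW ⟸ a machine whose assembled construction has (B) and whose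
forward-generated runs enter every small window** (the body of the rung item `…BalabanUVNodes.StabilityBAtRecord` at the family `F`,
generalised to `SU(N)`). [cite: Balaban1989LargeFieldII, Thm 1 p.355] -/
theorem exists_datumOfRecord₀_window_of_machine
    (h : ∃ M : RGMachine F (Matrix.specialUnitaryGroup (Fin N) ℂ),
      B16.EndStatementBPrinted (M.construction (Node00.avOfRecord F N)) ∧
        ∃ γ₁ : ℝ, 0 < γ₁ ∧ ∀ γ : ℝ, 0 < γ → γ ≤ γ₁ →
          ∃ P : B12.RunParams, (M.construction (Node00.avOfRecord F N) P).flow.InInterval γ P.K) :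
    ∃ D : FiniteEpsData F (Matrix.specialUnitaryGroup (Fin N) ℂ), Node00.IsDatumOfRecord₀ F N D ∧
      B16.EndStatementBPrinted D.C ∧
        ∃ γ₁ : ℝ, 0 < γ₁ ∧ ∀ γ : ℝ, 0 < γ → γ ≤ γ₁ → ∃ P : B12.RunParams, (D.C P).flow.InInterval γ P.K := by
  obtain ⟨M, hB, hw⟩ := h
  exact ⟨datumOfRecord F N M, isDatumOfRecord₀_datumOfRecord F N M, hB, hw⟩

/-- **(B) ∧ ENDPOINT EXISTENCE AT A STAGE-0 DATUM OF RECORD ⟸ a machine with both for its assembled construction** (the conclusion of the rung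
item `…BalabanUVNodes.EndpointGivenB` at `F`). [cite: Balaban1987RG1, Thm 2 p.259] -/
theorem exists_datumOfRecord₀_endpoint_of_machine
    (h : ∃ M : RGMachine F (Matrix.specialUnitaryGroup (Fin N) ℂ),
      B16.EndStatementBPrinted (M.construction (Node00.avOfRecord F N)) ∧
        DagBinding.EndpointExistence (M.construction (Node00.avOfRecord F N)).toB12) :
    ∃ D : FiniteEpsData F (Matrix.specialUnitaryGroup (Fin N) ℂ), Node00.IsDatumOfRecord₀ F N D ∧
      B16.EndStatementBPrinted D.C ∧ DagBinding.EndpointExistence D.C.toB12 := by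
  obtain ⟨M, hB, hE⟩ := h
  exact ⟨datumOfRecord F N M, isDatumOfRecord₀_datumOfRecord F N M, hB, hE⟩

/-- **(B) ∧ END ∧ THE HYBRID-NE7 SPINE UNDER END AT A STAGE-0 DATUM OF RECORD ⟸ a machine with the three at its assembled datum** (the body
of the rung leaf `…BalabanLadder.UV` at `F`, generalised to `SU(N)`); with `T4ContinuumYM4Torus.continuumYM4_torus_of_endpointExistence` and
B1 above, the continuum-limit targets then hold at `datumOfRecord F N M`. [cite: Balaban1989LargeFieldII, Thm 1 + (0.1) pp.355–356] -/
theorem exists_datumOfRecord₀_spine_of_machine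
    (h : ∃ M : RGMachine F (Matrix.specialUnitaryGroup (Fin N) ℂ),
      B16.EndStatementBPrinted (M.construction (Node00.avOfRecord F N)) ∧
        DagBinding.EndpointExistence (M.construction (Node00.avOfRecord F N)).toB12 ∧
          T4ApexHybrid.HybridNE7Under (datumOfRecord F N M)
            (DagBinding.EndpointExistence (M.construction (Node00.avOfRecord F N)).toB12)) :
    ∃ D : FiniteEpsData F (Matrix.specialUnitaryGroup (Fin N) ℂ), Node00.IsDatumOfRecord₀ F N D ∧
      B16.EndStatementBPrinted D.C ∧ DagBinding.EndpointExistence D.C.toB12 ∧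
        T4ApexHybrid.HybridNE7Under D (DagBinding.EndpointExistence D.C.toB12) := by
  obtain ⟨M, hB, hE, hNE⟩ := h
  exact ⟨datumOfRecord F N M, isDatumOfRecord₀_datumOfRecord F N M, hB, hE, hNE⟩

/-- **THE T⁴ APEX AT THE ASSEMBLED DATUM** (kernel): for every machine whose assembled construction carries (B) and endpoint existence and whose
assembled datum carries the hybrid-NE7 spine under END, `ContinuumYM4Torus (datumOfRecord F N M)` — binder B1 supplied by
`isPrintedAveraged_datumOfRecord`, the other three as hypotheses (`T4ContinuumYM4Torus.continuumYM4_torus_of_endpointExistence`). [cite: JaffeWittenClay2006, §6.5 p.11] -/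
theorem continuumYM4Torus_datumOfRecord
    (hB : B16.EndStatementBPrinted (datumOfRecord F N M).C)
    (hE : DagBinding.EndpointExistence (datumOfRecord F N M).C.toB12)
    (hNE : T4ApexHybrid.HybridNE7Under (datumOfRecord F N M) (DagBinding.EndpointExistence (datumOfRecord F N M).C.toB12)) :
    T4ContinuumYM4Torus.ContinuumYM4Torus (datumOfRecord F N M) :=
  T4ContinuumYM4Torus.continuumYM4_torus_of_endpointExistence _ (isPrintedAveraged_datumOfRecord F N M) hB hE hNE

end Record

end T4DatumAssembly

end Literature.MathematicalPhysics.QuantumFieldTheory.Balaban1983to89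

end
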